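import Literature.NumberTheory.Weil1964.ArchFollandHermiteSplit
import Literature.NumberTheory.Weil1964.AdelicMetaplecticReindex
import HarnessLib

/-!
# Folland–Hermite test vectors under a relabelling of the index type (S2, junction «cell coordinates → split coordinates»)

Topic `NumberTheory/Weil1964`; namespace `Literature.NumberTheory.Weil1964`.  THEOREMS ONLY (no definition, no named fact, no
instance; net Literature debt 0).  Cell `hodgecm-mathlib` (D-0151), fan B-III line (T2) [Liu2021, Thm 4.15], stub S2 «theta restricts to
theta», junction piece (A-p09 lead, probe (p)): the cell's theta test vectors live on `𝔸_F^κ` with `κ = Fin (N₁ + N₂) × Fin M`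
(Kronecker coordinates of `(V₁ ⊕ V₂) ⊗ W`) or `κ = Fin n`, whereas the product decomposition of S2d (`ArchFollandHermiteSplit`,
`ArchFollandGaussianSplit`) is written on the SPLIT index type `(Fin N₁ × Fin M) ⊕ (Fin N₂ × Fin M)`; the two are related by the
reindexing operator `R_e` (`piSBReindex`, `schwartzReindexCLM`, `finSBReindex` of `AdelicMetaplecticReindex`) along
`e = e_Σ`.  This file records that `R_e` carries Folland–Hermite vectors to Folland–Hermite vectors:

* `schwartzReindexCLM_follandHermite_scaledFrame` — for a bijection `e : ι ≃ ι'`, the archimedean reindexing `φ ↦ φ (· ∘ e)` sends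
  the Hermite function `h_β ∘ e_D` of the scaled real-place frame `e_D` on `(ι → F ⊗ ℝ)` ([Folland1989] §1.7 (1.81), §1.3 (1.25);
  tree `follandHermite`, `scaledFrame`) to the Hermite function `h_{β ∘ (e × 1)⁻¹} ∘ e_{D ∘ (e⁻¹ × 1)}` of the relabelled frame on
  `(ι' → F ⊗ ℝ)` — transport of `rename_herm` / `hermiteFun_comp_equiv` (relabelling the variables of a Hermite symbol);
* `piSBReindex_follandHermite_tmul` — the adelic form: `R_e (h_β ∘ e_D ⊗ f) = (h_{β∘} ∘ e_{D∘}) ⊗ R_e^f f` (with ★ `piSBReindex_tmul`);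
* `piSBReindex_symm_follandHermite_tmul` — the same for `R_e⁻¹ = R_{e⁻¹}`.

With `e := e_Σ = (finSumFinEquiv × 1)⁻¹ ≫ sumProdDistrib` these put every Folland–Hermite test vector of the big space in the
coordinates where `follandHermite_juxtaposed_eq_archBoxTensor` / `piSchwartzBruhatEquiv_follandHermite_sumIdx_tmul_eq_tensorToSum`
(S2d) and `AdelicSchwartzBruhatDirectSumSpan` apply («we can find finitely many pairs», [Liu2021] l. 2199–2203).
HC_CM is proved only modulo the 7 printed citations until rung 0 closes; this file discharges nothing by itself.

## References
* [Folland1989] G. B. Folland, *Harmonic Analysis in Phase Space*, Princeton UP (1989), §1.3 (1.25), §1.7 (1.81).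
* [Liu2021] Y. Liu, *Fourier–Jacobi cycles and arithmetic relative trace formula*, Camb. J. Math. 9 (2021), proof of Thm. 4.15
  (TeX `FJcycle.tex` l. 2193–2203).
-/

set_option autoImplicit false

noncomputable section

open NumberField NumberField.InfinitePlace NumberField.mixedEmbedding MvPolynomial
open Literature.Analysis.SegalBargmann Literature.NumberTheory.Automorphic
open scoped SchwartzMap TensorProduct Classical

namespace Literature.NumberTheory.Weil1964

variable {F : Type} [Field F] [NumberField F] [IsTotallyReal F] {ι ι' : Type} [Fintype ι] [Fintype ι']

/-- **Reindexing a Folland–Hermite vector along a bijection of the index type**: for `e : ι ≃ ι'`, scales `D` on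
`ι × {real places}` and a multi-index `β`, `R_e^∞ (h_β ∘ e_D) = h_{β ∘ (e × 1)⁻¹} ∘ e_{D ∘ (e⁻¹ × 1)}`, where `R_e^∞ φ = φ (· ∘ e)`
(`schwartzReindexCLM`).  Pointwise both sides are `hermiteFun (herm β)` at `k ↦ D k · (w (e k.1))_{k.2}` — relabelling the
variables of the Hermite symbol (`rename_herm`, `hermiteFun_comp_equiv`). [cite: Folland1989, §1.7 (1.81) and §1.3 (1.25)]
[cite: Liu2021, proof of Thm. 4.15 (FJcycle.tex l. 2199–2203)] -/
theorem schwartzReindexCLM_follandHermite_scaledFrame (e : ι ≃ ι')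
    (D : ι × {v : InfinitePlace F // v.IsReal} → ℝ) (hD : ∀ k, D k ≠ 0)
    (β : ι × {v : InfinitePlace F // v.IsReal} →₀ ℕ) :
    schwartzReindexCLM F e (follandHermite (scaledFrame F ι D hD) β) =
      follandHermite
        (scaledFrame F ι' (fun k => D (e.symm k.1, k.2)) (fun k => hD (e.symm k.1, k.2)))
        (β.equivMapDomain (e.prodCongr (Equiv.refl {v : InfinitePlace F // v.IsReal}))) := by
  ext w
  rw [schwartzReindexCLM_apply, follandHermite_apply, follandHermite_apply, hermitePi_apply, hermitePi_apply,
    ← rename_herm, ← hermiteFun_comp_equiv]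
  congr 1
  funext ⟨j, v⟩
  simp only [Function.comp_apply, scaledFrame_apply, Equiv.prodCongr_apply, Prod.map_apply, Equiv.coe_refl, id_eq,
    Equiv.symm_apply_apply]

/-- **Adelic form**: `R_e (h_β ∘ e_D ⊗ f) = (h_{β ∘ (e × 1)⁻¹} ∘ e_{D ∘ (e⁻¹ × 1)}) ⊗ R_e^f f` on `𝒮(𝔸_F^ι) → 𝒮(𝔸_F^{ι'})`
(`piSBReindex_tmul` + the previous lemma). [cite: Folland1989, §1.7 (1.81)] [cite: Liu2021, proof of Thm. 4.15 (FJcycle.tex l. 2199–2203)] -/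
theorem piSBReindex_follandHermite_tmul (e : ι ≃ ι')
    (D : ι × {v : InfinitePlace F // v.IsReal} → ℝ) (hD : ∀ k, D k ≠ 0)
    (β : ι × {v : InfinitePlace F // v.IsReal} →₀ ℕ) (f : FinSB F ι) :
    piSBReindex F e (piSchwartzBruhatEquiv F ι (follandHermite (scaledFrame F ι D hD) β ⊗ₜ f)) =
      piSchwartzBruhatEquiv F ι'
        (follandHermite (scaledFrame F ι' (fun k => D (e.symm k.1, k.2)) (fun k => hD (e.symm k.1, k.2)))
            (β.equivMapDomain (e.prodCongr (Equiv.refl {v : InfinitePlace F // v.IsReal}))) ⊗ₜ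
          finSBReindex F e f) := by
  rw [piSBReindex_tmul, schwartzReindexCLM_follandHermite_scaledFrame]

/-- **Inverse form**: `R_e⁻¹ ((h_β ∘ e_D) ⊗ f) = (h_{β ∘ (e⁻¹ × 1)⁻¹} ∘ e_{D ∘ (e × 1)}) ⊗ R_{e⁻¹}^f f` (`R_e⁻¹ = R_{e⁻¹}`,
`piSBReindex_symm`). [cite: Folland1989, §1.7 (1.81)] -/
theorem piSBReindex_symm_follandHermite_tmul (e : ι ≃ ι')
    (D : ι' × {v : InfinitePlace F // v.IsReal} → ℝ) (hD : ∀ k, D k ≠ 0)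
    (β : ι' × {v : InfinitePlace F // v.IsReal} →₀ ℕ) (f : FinSB F ι') :
    (piSBReindex F e).symm (piSchwartzBruhatEquiv F ι' (follandHermite (scaledFrame F ι' D hD) β ⊗ₜ f)) =
      piSchwartzBruhatEquiv F ι
        (follandHermite (scaledFrame F ι (fun k => D (e k.1, k.2)) (fun k => hD (e k.1, k.2)))
            (β.equivMapDomain (e.symm.prodCongr (Equiv.refl {v : InfinitePlace F // v.IsReal}))) ⊗ₜ
          finSBReindex F e.symm f) := by
  rw [piSBReindex_symm, piSBReindex_follandHermite_tmul]
  rfl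

end Literature.NumberTheory.Weil1964

end
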